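import Mathlib
import HarnessLib

/-!
# `NoHeavyLowerTail` (crux stmt-CriticalPhenomena-4575), antithetic vdBHK programme: the BALANCE BIJECTION of the stalk template (LEMMA B of THEOREM S) in the
# abstract `REL₀` frame

Support file (seat `prim-ineq-gen-7` gen 54; `--supports stmt-CriticalPhenomena-4575`).  No `sorry`, no definitions.  Companions: `AntitheticStalk` (transfer
identity, which ASSUMES the balance `#(𝐀*∩C01∩inner) = #(𝐀*∩C10∩inner)`), `AntitheticStalkSplit`.  Memo: run/shared/lean/prim/prim-ineq-gen-7/FINDING-STALK-g54.md §2.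

SETTING (memo §2, LEMMAS B/C).  Points of `TQ′` (colourings of `Q_u ∪ wedge`, `e` a new atom below the atom `u`) are triples `(ρ_e, ρ_u, w)`: the colours of
`e, u` (`true` = red) and the other colours `w : W`.  From the explicit Ω-order one reads off (memo LEMMA B): there is ONE relation `REL₀` on `W` — reflexive and
transitive — such that `(1,1,w₀) ≤ (0,1,w) ↔ REL₀ w₀ w`, `(1,0,w) ≤ (0,1,w') ↔ REL₀ w w'`, `(1,0,w) ≤ (0,0,w') ↔ REL₀ w w'`, and `REL₀ w₀ w' → (1,1,w₀) ≤ (0,0,w')`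
(the last relation is governed by a weaker condition); moreover (LEMMA C) nothing in class `(0,0)` lies below class `(0,1)` and nothing in class `(1,0)` lies below
class `(1,1)`.  Here `≤` is an arbitrary relation `le` with these properties (no order axioms are needed).
* `AntitheticStalkBalance.balance_pointwise` — **LEMMA B**: for every set `A` of diagonal points (classes `(1,1)`, `(0,0)`; no closure hypothesis is even needed)
  and every `w`,   `(0,1,w) ∈ ↑A  ↔  (every point above (1,0,w) outside class (1,0) lies in ↑A)`.
  The right side says `(1,0,w) ∈ 𝐀* = Int↑(↑δ𝐀 ∪ C10)`; so the `C01`-part of `↑δ𝐀` and the `C10`-part of `𝐀*` are indexed by the same `w`, whence the balance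
  (equal numbers of inner points, 'inner' being a property of `w` alone) used by `AntitheticStalk.stalk_transfer`.
-/

namespace Summit.CriticalPhenomena.PercolationContinuityZ3.Theorems

namespace AntitheticStalkBalance

variable {W : Type*}

/-- **LEMMA B (balance bijection of the stalk template), abstract `REL₀` frame.**  `le` a relation on `Bool × Bool × W` (first coordinate: colour of the new atom
`e`, second: colour of `u`; `true` = red), `rel₀` reflexive and transitive on `W`, with: `(1,1,w₀) ≤ (0,1,w) ↔ rel₀ w₀ w`; `(1,0,w) ≤ (0,1,w') ↔ rel₀ w w'`;
`(1,0,w) ≤ (0,0,w') ↔ rel₀ w w'`; `rel₀ w₀ w' → (1,1,w₀) ≤ (0,0,w')`; no `(0,0,·) ≤ (0,1,·)`; no `(1,0,·) ≤ (1,1,·)`.  Let `A` be any set of diagonal points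
(`A p → p.1 = p.2.1`).  Then for all `w`:
`(∃ p, A p ∧ le p (false,true,w)) ↔ (∀ q, le (true,false,w) q → ¬(q.1 = true ∧ q.2.1 = false) → ∃ p, A p ∧ le p q)`. [this work] -/
theorem balance_pointwise (le : Bool × Bool × W → Bool × Bool × W → Prop) (rel₀ : W → W → Prop)
    (hrefl : ∀ w, rel₀ w w) (htrans : ∀ w₁ w₂ w₃, rel₀ w₁ w₂ → rel₀ w₂ w₃ → rel₀ w₁ w₃)
    (h11_01 : ∀ w₀ w, le (true, true, w₀) (false, true, w) ↔ rel₀ w₀ w)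
    (h10_01 : ∀ w w', le (true, false, w) (false, true, w') ↔ rel₀ w w')
    (h10_00 : ∀ w w', le (true, false, w) (false, false, w') ↔ rel₀ w w')
    (h11_00 : ∀ w₀ w', rel₀ w₀ w' → le (true, true, w₀) (false, false, w'))
    (hno_00_01 : ∀ w w', ¬ le (false, false, w) (false, true, w'))
    (hno_10_11 : ∀ w w', ¬ le (true, false, w) (true, true, w'))
    (A : Bool × Bool × W → Prop) (hAdiag : ∀ p, A p → p.1 = p.2.1) (w : W) :
    (∃ p, A p ∧ le p (false, true, w)) ↔
      (∀ q : Bool × Bool × W, le (true, false, w) q → ¬ (q.1 = true ∧ q.2.1 = false) → ∃ p, A p ∧ le p q) := by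
  constructor
  · -- (→): the witness below (0,1,w) is a point (1,1,w₀) with rel₀ w₀ w
    rintro ⟨p, hAp, hle⟩ q hq hcl
    obtain ⟨pe, pu, w₀⟩ := p
    have hd : pe = pu := hAdiag _ hAp
    -- p cannot be in class (0,0)
    cases pe <;> cases pu
    · exact absurd hle (hno_00_01 w₀ w)
    · exact absurd hd (by decide)
    · exact absurd hd (by decide)
    · have hr₀ : rel₀ w₀ w := (h11_01 w₀ w).mp hle
      obtain ⟨qe, qu, w'⟩ := q
      cases qe <;> cases qu
      · -- q = (0,0,w')
        have hr : rel₀ w w' := (h10_00 w w').mp hq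
        exact ⟨(true, true, w₀), hAp, h11_00 w₀ w' (htrans _ _ _ hr₀ hr)⟩
      · -- q = (0,1,w')
        have hr : rel₀ w w' := (h10_01 w w').mp hq
        exact ⟨(true, true, w₀), hAp, (h11_01 w₀ w').mpr (htrans _ _ _ hr₀ hr)⟩
      · -- q = (1,0,w'): excluded
        exact absurd ⟨rfl, rfl⟩ hcl
      · -- q = (1,1,w'): impossible above (1,0,w)
        exact absurd hq (hno_10_11 w w')
  · -- (←): apply to q = (0,1,w), which lies above (1,0,w) by reflexivity of rel₀
    intro h
    exact h (false, true, w) ((h10_01 w w).mpr (hrefl w)) (by simp)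

/-- **Corollary (the (0,0)-exits land in `A` itself).**  Under the same hypotheses, if `(0,1,w) ∈ ↑A` then every `(0,0,w')` above `(1,0,w)` is a point
of `A` (not merely of `↑A`): the diagonal is convex for `A`.  This is the form used in the memo ('the (0,0)-part of `𝐀*` is `δ` of the `u`-blue part of `𝐀`').
[this work] -/
theorem exits_in_A (le : Bool × Bool × W → Bool × Bool × W → Prop) (rel₀ : W → W → Prop)
    (htrans : ∀ w₁ w₂ w₃, rel₀ w₁ w₂ → rel₀ w₂ w₃ → rel₀ w₁ w₃)
    (h11_01 : ∀ w₀ w, le (true, true, w₀) (false, true, w) ↔ rel₀ w₀ w)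
    (h10_00 : ∀ w w', le (true, false, w) (false, false, w') ↔ rel₀ w w')
    (h11_00 : ∀ w₀ w', rel₀ w₀ w' → le (true, true, w₀) (false, false, w'))
    (hno_00_01 : ∀ w w', ¬ le (false, false, w) (false, true, w'))
    (A : Bool × Bool × W → Prop) (hAdiag : ∀ p, A p → p.1 = p.2.1)
    (hAup : ∀ p q, A p → q.1 = q.2.1 → le p q → A q) (w w' : W)
    (hw : ∃ p, A p ∧ le p (false, true, w)) (hq : le (true, false, w) (false, false, w')) :
    A (false, false, w') := by
  obtain ⟨⟨pe, pu, w₀⟩, hAp, hle⟩ := hw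
  have hd : pe = pu := hAdiag _ hAp
  cases pe <;> cases pu
  · exact absurd hle (hno_00_01 w₀ w)
  · exact absurd hd (by decide)
  · exact absurd hd (by decide)
  · have hr₀ : rel₀ w₀ w := (h11_01 w₀ w).mp hle
    have hr : rel₀ w w' := (h10_00 w w').mp hq
    exact hAup (true, true, w₀) (false, false, w') hAp rfl (h11_00 w₀ w' (htrans _ _ _ hr₀ hr))

end AntitheticStalkBalance

end Summit.CriticalPhenomena.PercolationContinuityZ3.Theorems
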